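import Mathlib.Algebra.Field.ZMod
import Mathlib.Algebra.Polynomial.Eval.Degree
import Mathlib.Data.ZMod.Basic
import Mathlib.LinearAlgebra.Lagrange
import Literature.InformationTheory.Coding.DualDistance
import Literature.InformationTheory.Coding.OnePointAGCodesDual
import Literature.InformationTheory.Coding.OnePointAGCodesRS
import HarnessLib

/-!
# The OPI constraint code: Reed–Solomon structure, dual distance `≥ n + 1`, and
`n`-wise uniformity of the constraint values of a uniformly random assignment

The Optimal Polynomial Intersection problem OPI(`p`, `n`) of Jordan et al. asks, for a prime `p`,
a degree bound `n - 1` and allowed sets `F_y ⊆ 𝔽_p` (`y ∈ 𝔽_p^*`), for a polynomial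
`Q ∈ 𝔽_p[X]` of degree `≤ n - 1` maximising `|{y ∈ 𝔽_p^* : Q(y) ∈ F_y}|`. Written as max-LINSAT
it has `m = p - 1` constraints on the values `(B x)_y = Σ_{j<n} y^j x_j = Q_x(y)` of the
constraint matrix `B_{y j} = y^j` applied to the coefficient vector `x ∈ 𝔽_p^n`
[cite: JordanEtAl2024DQI, §5, eq. (BRS) and the surrounding text (arXiv v5 p. 11)].
(Jordan et al. index the rows by `i = 0, …, p - 2` through `y = γ^i` for a primitive root `γ`;
we index them by `y = i + 1`, `i : Fin (p - 1)` — the same rows up to a permutation.)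

Proved here (no named facts):

* `opiNode p i = i + 1` enumerates `𝔽_p^*` injectively (`opiNode_injective`, `opiNode_ne_zero`);
  `opiMatrix p n` is `B`; `opiMatrix_mulVec` : `(B x)_i = Q_x(opiNode i)` with
  `Q_x = Σ_j C(x_j) X^j` (`coeffPoly`).
* `mem_range_opiMatrix_iff` : the constraint code `{B x}` is the Reed–Solomon / rational one-point
  code `C(D, (n-1)·P_∞)` of `OnePointAGCodesRS.lean` at the nodes `𝔽_p^*` — the evaluations of
  all polynomials of degree `≤ n - 1`.
* `dualDist_range_opiMatrix` : **its dual distance is `≥ n + 1`** (Goppa's bound at genus `0`,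
  `OnePointData.le_dualDist_code`) — "`C^⊥ = {d : Bᵀ d = 0}` is a Reed–Solomon code with …
  distance `n + 1`" [cite: JordanEtAl2024DQI, §5 (p. 11)]; this is the hypothesis
  `2ℓ + 1 < d^⊥` of their semicircle-law theorem in the form `2ℓ + 1 < n + 1`.
* `opiMatrix_restrict_surjective` : for every set `S` of at most `n` constraints the map
  `x ↦ (B x)|_S` is ONTO `𝔽_p^S` (Lagrange interpolation through `|S| ≤ n` nodes), hence
* `map_restrict_opiMatrix_uniformOfFintype` : **if `x` is uniform on `𝔽_p^n`, any `≤ n` constraint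
  values `((B x)_y)_{y ∈ S}` are jointly uniform on `𝔽_p^S`** (`n`-wise independence; the
  orthogonal-array property of a code of dual distance `n + 1`, cf. `DualDistance.lean`). In
  particular the number of satisfied constraints among any `k ≤ n` of them is distributed exactly
  as for `k` independent uniform symbols, which is what makes the first `n` moments of the
  max-LINSAT score of a uniformly random assignment binomial — the finite-size input to
  [cite: JordanEtAl2024DQI, Thm. 4.1 / §8 (semicircle law), hypothesis `2ℓ + 1 < d^⊥`].

Written for the pub-qadeq cell (claim A-18 / OPEN-5: the validation identities of the second
block-Gibbs implementation rest on this `n`-wise uniformity) and usable by route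
`QuantumAdvantage/CodeCarries` (whose OPI conventions evaluate `Q` at `j + 1`, `j < p - 1`, as
here). No statement about DQI, about OPI's complexity, or about any complexity class is made.

## References

* [JordanEtAl2024DQI] S. P. Jordan, N. Shutty, M. Wootters, A. Zalcman, A. Schmidhuber, R. King,
  S. V. Isakov, T. Khattar, R. Babbush, *Optimization by Decoded Quantum Interferometry*,
  arXiv:2408.08292v5, Nature 646, 831–836 (2025), §5 (OPI; `B_{ij} = γ^{ij}`; dual RS code of
  distance `n + 1`). Held (`lit read arxiv:2408.08292`, chunk p0011).
* [Stichtenoth2009] H. Stichtenoth, *Algebraic Function Fields and Codes*, 2nd ed., §2.3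
  (rational AG codes = generalised Reed–Solomon codes; `d^⊥ ≥ a + 2`), via
  `OnePointAGCodesRS.lean` / `OnePointAGCodesDual.lean`.
-/

noncomputable section

namespace Literature.InformationTheory.Coding

open Polynomial Finset Matrix

variable (p : ℕ)

/-- The OPI evaluation nodes: `opiNode p i = i + 1 ∈ 𝔽_p`, `i : Fin (p - 1)`, i.e. the nonzero
residues `1, …, p - 1`. [cite: JordanEtAl2024DQI, §5 (p. 11): constraints indexed by `𝔽_p^*`] -/
def opiNode (i : Fin (p - 1)) : ZMod p := (((i : ℕ) + 1 : ℕ) : ZMod p)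

/-- The nodes are pairwise distinct. [folklore] -/
theorem opiNode_injective : Function.Injective (opiNode p) := by
  intro i j hij
  have hi : (i : ℕ) + 1 < p := by have := i.2; omega
  have hj : (j : ℕ) + 1 < p := by have := j.2; omega
  have h := (ZMod.natCast_eq_natCast_iff' ((i : ℕ) + 1) ((j : ℕ) + 1) p).1 hij
  rw [Nat.mod_eq_of_lt hi, Nat.mod_eq_of_lt hj] at h
  exact Fin.ext (by omega)

/-- The nodes are nonzero. [folklore] -/
theorem opiNode_ne_zero (i : Fin (p - 1)) : opiNode p i ≠ 0 := by
  have hi : (i : ℕ) + 1 < p := by have := i.2; omega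
  rw [opiNode, Ne, ZMod.natCast_eq_zero_iff]
  exact fun h => absurd (Nat.le_of_dvd (Nat.succ_pos _) h) (by omega)

/-- The OPI / max-LINSAT constraint matrix `B ∈ 𝔽_p^{(p-1) × n}`, `B_{i j} = (i+1)^j`.
[cite: JordanEtAl2024DQI, §5 eq. (BRS) (p. 11), rows re-indexed by `𝔽_p^*` instead of `γ^i`] -/
def opiMatrix (n : ℕ) : Matrix (Fin (p - 1)) (Fin n) (ZMod p) :=
  Matrix.of fun i j => opiNode p i ^ (j : ℕ)

/-- Entries of `B`. [folklore] -/
@[simp] theorem opiMatrix_apply (n : ℕ) (i : Fin (p - 1)) (j : Fin n) :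
    opiMatrix p n i j = opiNode p i ^ (j : ℕ) := rfl

/-- The polynomial `Q_x = Σ_{j<n} x_j X^j` with coefficient vector `x`. [folklore] -/
def coeffPoly {n : ℕ} (x : Fin n → ZMod p) : (ZMod p)[X] := ∑ j : Fin n, C (x j) * X ^ (j : ℕ)

/-- `deg Q_x ≤ n - 1` (indeed `< n`). [folklore] -/
theorem degree_coeffPoly_lt {n : ℕ} (x : Fin n → ZMod p) : (coeffPoly p x).degree < n :=
  Polynomial.degree_sum_fin_lt x

/-- Evaluating `Q_x` at a point is the corresponding row of `B x`. [folklore] -/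
theorem eval_coeffPoly {n : ℕ} (x : Fin n → ZMod p) (y : ZMod p) :
    (coeffPoly p x).eval y = ∑ j : Fin n, y ^ (j : ℕ) * x j := by
  simp only [coeffPoly, eval_finsetSum, eval_mul, eval_C, eval_pow, eval_X]
  exact Finset.sum_congr rfl fun j _ => mul_comm _ _

/-- **`(B x)_i = Q_x(i + 1)`**: the `i`-th constraint value is the value of the coefficient
polynomial at the `i`-th node. [cite: JordanEtAl2024DQI, §5 (p. 11): "`b_i · q = Q(γ^i)`"] -/
theorem opiMatrix_mulVec {n : ℕ} (x : Fin n → ZMod p) (i : Fin (p - 1)) :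
    (opiMatrix p n *ᵥ x) i = (coeffPoly p x).eval (opiNode p i) := by
  rw [eval_coeffPoly]
  simp [Matrix.mulVec, dotProduct]

/-- A polynomial of degree `< n` is the coefficient polynomial of its first `n` coefficients.
[folklore] -/
theorem coeffPoly_coeff_eq {n : ℕ} {Q : (ZMod p)[X]} (hQ : Q.degree < n) :
    coeffPoly p (fun j : Fin n => Q.coeff j) = Q := by
  by_cases h0 : Q = 0
  · subst h0; simp [coeffPoly]
  · have hnat : Q.natDegree < n := (Polynomial.natDegree_lt_iff_degree_lt h0).2 hQ
    unfold coeffPoly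
    simp_rw [Polynomial.C_mul_X_pow_eq_monomial]
    rw [Fin.sum_univ_eq_sum_range (fun i => Polynomial.monomial i (Q.coeff i)) n]
    exact (Q.as_sum_range' n hnat).symm

section Code

variable [hp : Fact p.Prime]

/-- **The constraint code `{B x : x ∈ 𝔽_p^n}` is the Reed–Solomon code of polynomials of degree
`≤ n - 1` evaluated on `𝔽_p^*`** (the rational one-point code `C(D, (n-1)P_∞)` of
`OnePointAGCodesRS.lean`), for `n ≥ 1`. [cite: JordanEtAl2024DQI, §5 (p. 11)] -/
theorem mem_range_opiMatrix_iff {n : ℕ} (hn : 1 ≤ n) (c : Fin (p - 1) → ZMod p) :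
    c ∈ LinearMap.range (opiMatrix p n).mulVecLin ↔
      c ∈ (OnePointData.reedSolomon (opiNode p) (opiNode_injective p)).code (n - 1) := by
  rw [LinearMap.mem_range, OnePointData.mem_code_iff]
  constructor
  · rintro ⟨x, rfl⟩
    refine ⟨coeffPoly p x, ?_, funext fun i => ?_⟩
    · show (coeffPoly p x).degree ≤ ((n - 1 : ℕ) : WithBot ℕ)
      have h := degree_coeffPoly_lt p x
      by_cases h0 : coeffPoly p x = 0
      · rw [h0, Polynomial.degree_zero]; exact bot_le
      · have := (Polynomial.natDegree_lt_iff_degree_lt h0).2 h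
        exact Polynomial.degree_le_of_natDegree_le (by omega)
    · show Polynomial.aeval (opiNode p i) (coeffPoly p x) = (opiMatrix p n).mulVecLin x i
      rw [Matrix.mulVecLin_apply, opiMatrix_mulVec, coe_aeval_eq_eval]
  · rintro ⟨Q, hQ, rfl⟩
    refine ⟨fun j : Fin n => Q.coeff j, funext fun i => ?_⟩
    have hQn : Q.degree < n := by
      refine lt_of_le_of_lt hQ ?_
      exact_mod_cast (show n - 1 < n by omega)
    show ((opiMatrix p n).mulVecLin fun j : Fin n => Q.coeff j) i = Polynomial.aeval (opiNode p i) Q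
    rw [Matrix.mulVecLin_apply, opiMatrix_mulVec, coeffPoly_coeff_eq p hQn, coe_aeval_eq_eval]

/-- The constraint code as the Reed–Solomon one-point code, as an equality of submodules.
[cite: JordanEtAl2024DQI, §5 (p. 11)] -/
theorem range_opiMatrix_eq_code {n : ℕ} (hn : 1 ≤ n) :
    LinearMap.range (opiMatrix p n).mulVecLin =
      (OnePointData.reedSolomon (opiNode p) (opiNode_injective p)).code (n - 1) :=
  Submodule.ext fun c => mem_range_opiMatrix_iff p hn c

/-- **Dual distance of the OPI constraint code is at least `n + 1`** ("`C^⊥` is a Reed–Solomon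
code with … distance `n + 1`"), via Goppa's bound `a + 2 - 2g ≤ d^⊥` at genus `0`, `a = n - 1`.
[cite: JordanEtAl2024DQI, §5 (p. 11)] -/
theorem dualDist_range_opiMatrix {n : ℕ} (hn : 1 ≤ n) :
    ((n + 1 : ℕ) : ℕ∞) ≤ dualDist (LinearMap.range (opiMatrix p n).mulVecLin) := by
  classical
  rw [range_opiMatrix_eq_code p hn]
  have h := (OnePointData.reedSolomon (opiNode p) (opiNode_injective p)).le_dualDist_code (n - 1)
  rw [OnePointData.genus_reedSolomon] at h
  have h' : n - 1 + 2 - 2 * 0 = n + 1 := by omega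
  rwa [h'] at h

end Code

section Uniform

variable [hp : Fact p.Prime]

/-- **Any `≤ n` constraint values are freely prescribable**: for `|S| ≤ n` the map
`x ↦ (B x)|_S` is onto `𝔽_p^S` (Lagrange interpolation through the `|S|` distinct nodes gives a
polynomial of degree `< |S| ≤ n`). [folklore] -/
theorem opiMatrix_restrict_surjective {n : ℕ} (S : Finset (Fin (p - 1))) (hS : S.card ≤ n) :
    Function.Surjective fun x : Fin n → ZMod p => S.restrict (opiMatrix p n *ᵥ x) := by
  classical
  intro y
  -- extend `y` to all indices and interpolate at the nodes of `S`
  let r : Fin (p - 1) → ZMod p := fun i => if h : i ∈ S then y ⟨i, h⟩ else 0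
  let Q : (ZMod p)[X] := Lagrange.interpolate S (opiNode p) r
  have hinj : Set.InjOn (opiNode p) S := (opiNode_injective p).injOn
  have hSn : ((S.card : ℕ) : WithBot ℕ) ≤ (n : WithBot ℕ) := by exact_mod_cast hS
  have hdeg : Q.degree < n := lt_of_lt_of_le (Lagrange.degree_interpolate_lt r hinj) hSn
  refine ⟨fun j : Fin n => Q.coeff j, funext fun i => ?_⟩
  show (opiMatrix p n *ᵥ fun j : Fin n => Q.coeff j) i = y i
  rw [opiMatrix_mulVec, coeffPoly_coeff_eq p hdeg, Lagrange.eval_interpolate_at_node r hinj i.2]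
  simp [r, i.2]

/-- The restricted constraint map as a linear map `𝔽_p^n → 𝔽_p^S`. [folklore] -/
def opiRestrictLin (n : ℕ) (S : Finset (Fin (p - 1))) :
    (Fin n → ZMod p) →ₗ[ZMod p] (S → ZMod p) :=
  (LinearMap.funLeft (ZMod p) (ZMod p) ((↑) : S → Fin (p - 1))).comp (opiMatrix p n).mulVecLin

/-- The linear map agrees with `x ↦ (B x)|_S`. [folklore] -/
theorem opiRestrictLin_apply (n : ℕ) (S : Finset (Fin (p - 1))) (x : Fin n → ZMod p) :
    opiRestrictLin p n S x = S.restrict (opiMatrix p n *ᵥ x) := rfl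

/-- **`n`-wise uniformity of the constraint values of a uniformly random assignment**: if `x` is
uniform on `𝔽_p^n` and `|S| ≤ n`, then `((B x)_y)_{y ∈ S}` is uniform on `𝔽_p^S` — the
orthogonal-array / `(d^⊥ - 1)`-wise-independence property of a code of dual distance `n + 1`,
here obtained directly from `opiMatrix_restrict_surjective` and the fact that surjective group
homomorphisms preserve uniform distributions (`DualDistance.map_uniformOfFintype_of_surjective`).
[cite: JordanEtAl2024DQI, §5 with §8 (semicircle law: the hypothesis `2ℓ + 1 < d^⊥ = n + 1`)] -/
theorem map_restrict_opiMatrix_uniformOfFintype {n : ℕ} (S : Finset (Fin (p - 1)))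
    (hS : S.card ≤ n) :
    (PMF.uniformOfFintype (Fin n → ZMod p)).map
        (fun x : Fin n → ZMod p => S.restrict (opiMatrix p n *ᵥ x)) =
      PMF.uniformOfFintype (S → ZMod p) := by
  classical
  have h := map_uniformOfFintype_of_surjective (opiRestrictLin p n S)
    (by
      intro y
      obtain ⟨x, hx⟩ := opiMatrix_restrict_surjective p S hS y
      exact ⟨x, by rw [opiRestrictLin_apply]; exact hx⟩)
  exact h

/-- Consequently the probability that the constraint values on `S` (`|S| ≤ n`) fall in a
prescribed set `A ⊆ 𝔽_p^S` is `|A| / p^{|S|}`, exactly as for `|S|` independent uniform symbols.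
[folklore] -/
theorem prob_restrict_opiMatrix_mem {n : ℕ} (S : Finset (Fin (p - 1))) (hS : S.card ≤ n)
    (A : Set (S → ZMod p)) [Fintype A] :
    ((PMF.uniformOfFintype (Fin n → ZMod p)).map
        (fun x : Fin n → ZMod p => S.restrict (opiMatrix p n *ᵥ x))).toOuterMeasure A =
      Fintype.card A / Fintype.card (S → ZMod p) := by
  rw [map_restrict_opiMatrix_uniformOfFintype p S hS]
  exact PMF.toOuterMeasure_uniformOfFintype_apply A

/-- **Independence of the constraint-satisfaction events on `≤ n` constraints**: for allowed sets
`F i ⊆ 𝔽_p` and `|S| ≤ n`, the probability over a uniform assignment `x ∈ 𝔽_p^n` that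
`(B x)_i ∈ F_i` for every `i ∈ S` equals `∏_{i ∈ S} |F_i| / p^{|S|}`, the product of the
single-constraint probabilities — the form in which the `n`-wise uniformity enters moment
computations of the max-LINSAT score of a random assignment.
[cite: JordanEtAl2024DQI, §5 with §8 (hypothesis `2ℓ + 1 < d^⊥ = n + 1`)] -/
theorem prob_forall_mem_allowed {n : ℕ} (S : Finset (Fin (p - 1))) (hS : S.card ≤ n)
    (F : Fin (p - 1) → Finset (ZMod p)) :
    ((PMF.uniformOfFintype (Fin n → ZMod p)).map
        (fun x : Fin n → ZMod p => S.restrict (opiMatrix p n *ᵥ x))).toOuterMeasure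
        {y : S → ZMod p | ∀ i : S, y i ∈ F i} =
      (∏ i ∈ S, ((F i).card : ENNReal)) / ((p : ENNReal) ^ S.card) := by
  classical
  rw [prob_restrict_opiMatrix_mem p S hS]
  have e : {y : S → ZMod p | ∀ i : S, y i ∈ F i} ≃ ((i : S) → (F i)) :=
    Equiv.subtypePiEquivPi
  have hnum : Fintype.card {y : S → ZMod p | ∀ i : S, y i ∈ F i} = ∏ i ∈ S, (F i).card := by
    rw [Fintype.card_congr e, Fintype.card_pi]
    simp_rw [Fintype.card_coe]
    exact Finset.prod_coe_sort S fun i => (F i).card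
  have hden : Fintype.card (S → ZMod p) = p ^ S.card := by
    rw [Fintype.card_fun, ZMod.card, Fintype.card_coe]
  rw [hnum, hden, Nat.cast_prod, Nat.cast_pow]

end Uniform

end Literature.InformationTheory.Coding

end
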